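import Summits.Ventures.PercRepro2.CaseOneStarCertT1
import Summits.Ventures.PercRepro2.CaseOneGadgetUWA1BBlockII0
import Summits.Ventures.PercRepro2.CaseOneGadgetUWA1BBlockII1
import Summits.Ventures.PercRepro2.CaseOneGadgetUWA1BBlockII2
import Summits.Ventures.PercRepro2.CaseOneGadgetUWA1BBlockII3
import Summits.Ventures.PercRepro2.CaseOneGadgetUWA1BBlockII4
import Summits.Ventures.PercRepro2.CaseOneGadgetUWA1BBlockII5
import Summits.Ventures.PercRepro2.CaseOneGadgetUWA1BBlockII6
import Summits.Ventures.PercRepro2.CaseOneGadgetUWA1BBlockII7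
import Summits.Ventures.PercRepro2.CaseOneGadgetUWA1BBlockII8
import Summits.Ventures.PercRepro2.CaseOneGadgetUWA1BBlockII9
import Summits.Ventures.PercRepro2.CaseOneGadgetUWA1BBlockII10
import Summits.Ventures.PercRepro2.CaseOneGadgetUWA1BBlockII11
import Summits.Ventures.PercRepro2.CaseOneGadgetUWA1BBlockII12
import Summits.Ventures.PercRepro2.CaseOneGadgetUWA1BBlockII13
import Summits.Ventures.PercRepro2.CaseOneGadgetUWA1BBlockII14
import Summits.Ventures.PercRepro2.CaseOneStarFactsB

/-!
# The gadget `u ~ {w, a₁, b}`, `w ~ {u, a₂, o}` (uwa1b): the cell certificates of `iiAB5` (part 40j)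
(blind cell PercRepro2, p1 g34; the fourth gadget anchor of the six-form calculus — all six forms of the uwa1b gadget
as plain SFacts-cone certificate chains, generated by mining/p1/g34/uwa1b/genu.py = p1 g33's gent_uwa1.py / g25's
geno.py re-targeted; P1-G33 §6–§6″, P1-G34)

Each `eBABII ijk kl` is a nonnegative combination of `(pairwise atom) × (cell)` and cubic cell monomials — or, for the degree-4 ones, `M × eBABII ijk kl` (`M = Σ cᵢ` the total cell mass) is a nonnegative combination of `(atom) × (cell) × (cell)` and quartic cell monomials, then `SFacts.nonneg_of_sum_mul` (`CaseOneStarCertT1`) — exact LP certificates (kit j318477, every certificate re-verified exactly; data/p1/g33/gcerts_ii_uwa1b.json, form `ii`), here as exact `linear_combination`s over `SFacts` (the rational coefficients cleared by their common denominator). -/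

namespace Summit.Ventures.PercRepro2

namespace CaseOne

section CertABII40j
variable {R : Type*} [Field R] [LinearOrder R] [IsStrictOrderedRing R]

set_option maxHeartbeats 0 in
/-- `eBABII32332 ≥ 0`: the combination is identically zero (`ring`). -/
lemma eBABII32332_nonneg (m : SCells R) (_hf : SFactsB m) : 0 ≤ eBABII32332 m := by
  have h : eBABII32332 m = 0 := by
    unfold eBABII32332 cBABII00132 cBABII00232 cBABII01032 cBABII01132 cBABII01232 cBABII01332 cBABII02032 cBABII02132 cBABII02232 cBABII02332 cBABII10132 cBABII10232 cBABII10332 cBABII11032 cBABII11132 cBABII11232 cBABII11332 cBABII12032 cBABII12132 cBABII12232 cBABII12332 cBABII20132 cBABII20232 cBABII20332 cBABII21032 cBABII21132 cBABII21232 cBABII21332 cBABII22032 cBABII22132 cBABII22232 cBABII22332 cBABII30232 cBABII30332 cBABII31132 cBABII31232 cBABII31332 cBABII32032 cBABII32132 cBABII32232 cBABII32332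
    ring
  linarith [h]

set_option maxHeartbeats 0 in
/-- `eBABII33000 ≥ 0`: the combination is identically zero (`ring`). -/
lemma eBABII33000_nonneg (m : SCells R) (_hf : SFactsB m) : 0 ≤ eBABII33000 m := by
  have h : eBABII33000 m = 0 := by
    unfold eBABII33000 cBABII01000 cBABII02000
    ring
  linarith [h]

set_option maxHeartbeats 0 in
/-- `eBABII33001 ≥ 0`: the combination is identically zero (`ring`). -/
lemma eBABII33001_nonneg (m : SCells R) (_hf : SFactsB m) : 0 ≤ eBABII33001 m := by
  have h : eBABII33001 m = 0 := by
    unfold eBABII33001 cBABII01001 cBABII02001 cBABII10001 cBABII11001 cBABII12001 cBABII13001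
    ring
  linarith [h]

end CertABII40j

end CaseOne

end Summit.Ventures.PercRepro2
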